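import Mathlib.Algebra.CharZero.Infinite
import Mathlib.Algebra.Polynomial.FieldDivision
import Mathlib.Algebra.Polynomial.Identities
import Mathlib.Algebra.Polynomial.AlgebraMap
import Mathlib.Algebra.Polynomial.Derivative
import Mathlib.Algebra.MvPolynomial.Equiv
import Mathlib.Algebra.MvPolynomial.Funext
import Mathlib.Algebra.MvPolynomial.Monad
import Mathlib.RingTheory.MvPolynomial.Basic
import Mathlib.RingTheory.MvPolynomial.Homogeneous
import Literature.Computability.AlgebraicComplexity.CoefficientExtraction
import Literature.Computability.AlgebraicComplexity.HomogeneousComponentsComplexity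
import HarnessLib

/-!
# Closure under taking roots: a root `f` of a nonzero `H(x, y)` with small circuits has small
# circuits (Newton iteration; the special case of Kaltofen's factor theorem used by
# Kabanets–Impagliazzo)

Topic `Computability/AlgebraicComplexity`. Let `F` be a field of characteristic zero,
`H ∈ F[x_b : b ∈ β][y]` (variables `Option β`, `y = X none`) nonzero, and `f ∈ F[x]` with
`H(x, f(x)) = 0`. Then
`L(f) ≤ (L(H) + deg H + deg f + #β + 4)^7` (`complexity_le_pow_of_isRoot`; the finer polynomial
is `complexity_le_of_isRoot`), where `L = complexity` is the tree's fan-in-two circuit size with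
free constants (`ArithCircuit.lean`). This is the case "`g = y - f(x)` is a factor of `H`" of
Kaltofen's theorem (every factor of a polynomial with small circuits has small circuits;
Bürgisser 2024 Thm. 3.2, in the tree the NAMED FACT `KaltofenFactorBoundWith`) — exactly the case
through which Kaltofen's theorem enters the Kabanets–Impagliazzo generator (KI 2003, Lemma 30:
the hard polynomial is a ROOT of the annihilator after the hybrid argument) and hence
Kumar–Ramya–Saptharishi–Tengse 2022. It is PROVED here, so that those results become
unconditional in the tree.

**The argument** (Dvir–Shpilka–Yehudayoff 2009, Lemma 3.1, "slow Newton iteration" in the words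
of Dutta–Saxena–Sinhababu 2018, §1.3: `Y_{t+1} = Y_t - H(x, Y_t) / ∂_y H(0, Y_1)`,
`Y_t ≡ f mod ⟨x⟩^t`; with the preprocessing "differentiate `H` w.r.t. `y` (multiplicity − 1)
times so that the root becomes simple" of Dutta–Saxena–Sinhababu 2018, proof of Thm. 3, and the
coefficient interpolation trick loc. cit.; Bürgisser 2004 for the power-series-root approach to
Kaltofen's theorem):

1. (`complexity_optionEquivLeft_symm_iterate_derivative_le`) the `y`-derivatives
   `∂_y^k H` cost `≤ (d+2)² (L(H) + 4)`, `d ≥ deg_y H`: the `y`-coefficients of `H` are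
   `F`-linear combinations of the `d + 1` specialisations `H(x, a)`, `a = 0, …, d` (dual
   Vandermonde coefficients `vandermondeDual` of `CoefficientExtraction.lean`);
2. if `f` is a root of `H` of multiplicity `m ≥ 1` then `f` is a SIMPLE root of `∂_y^{m-1} H`
   (characteristic zero: `Polynomial.eval_iterate_derivative_rootMultiplicity`);
3. after a translation `x ↦ x + a` (free up to `#β` gates each way) the constant term `ξ` of
   `∂_y G(x, f(x))` is a nonzero scalar (`G` the derivative from 2.; `F` infinite);
4. (`complexity_le_of_simpleRoot`) **Newton iteration with linear convergence**: with
   `Φ(z) = z - ξ⁻¹ G(x, z)` — ONE substitution into the fixed polynomial `y - ξ⁻¹ G`, so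
   `L(Φ(z)) ≤ L(z) + L(G) + 2` (`complexity_aeval_le`) — the iterates `z_0 = f(0)`,
   `z_{r+1} = Φ(z_r)` satisfy `z_r ≡ f (mod ⟨x⟩^{r+1})` (all homogeneous components of degree
   `≤ r` agree: first-order Taylor expansion `Polynomial.binomExpansion`, the error term has
   vanishing order `≥ r + 2`), hence `f = Σ_{i ≤ deg f} (z_{deg f})^{(i)}` and ONE truncation
   (`complexity_sum_homogeneousComponent_le`, BCS Lemma (21.25): cost `(D+2)² · L + D + 1`,
   independent of the degree of the iterate) gives `L(f) ≤ (D+2)² · D · (L(G) + 2) + D + 1`,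
   `D = deg f`.

No new definitions; characteristic zero is used in 1. (distinct integer nodes) and 2.
(`m! ≠ 0`). Constants are generous (total degree for `y`-degree in the coarse form).

WHAT THIS IS NOT: not Kaltofen's theorem for general factors (Hensel lifting / the
all-roots-to-factor linear algebra step is not formalised), not an algorithm, nothing in positive
characteristic.

## References

* [DvirShpilkaYehudayoff2009] Z. Dvir, A. Shpilka, A. Yehudayoff, *Hardness-randomness tradeoffs
  for bounded depth arithmetic circuits*, SIAM J. Comput. 39 (2009), Lemma 3.1 (roots of
  polynomials with small circuits via homogeneous Newton iteration).
* [DuttaSaxenaSinhababu2018] P. Dutta, N. Saxena, A. Sinhababu, *Discovering the roots: uniform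
  closure results for algebraic classes under factoring*, STOC 2018 / arXiv:1710.03214, §1.3
  ("slow Newton iteration" formula) and the proof of Thm. 3 (differentiate `γ_i - 1` times;
  coefficients by interpolation).
* [Burgisser2004Factors] P. Bürgisser, *The complexity of factors of multivariate polynomials*,
  Found. Comput. Math. 4 (2004), §3 (Newton approximation of roots).
* [KabanetsImpagliazzo2003] V. Kabanets, R. Impagliazzo, *Derandomizing polynomial identity tests
  means proving circuit lower bounds*, STOC 2003, Lemma 30 (where the root case is used).
* [BurgisserClausenShokrollahi1997] P. Bürgisser, M. Clausen, M. A. Shokrollahi, *Algebraic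
  Complexity Theory*, Lemma (21.25) (homogeneous components).
-/

noncomputable section

namespace Literature.Computability.AlgebraicComplexity

open MvPolynomial Finset

/-! ### Substitution for the distinguished variable and translations -/

section Subst

variable {F : Type*} [Field F] {β : Type*}

/-- `optionEquivLeft` turns the substitution `y ↦ z` (`x` fixed) into evaluation of the
univariate polynomial `H ∈ F[x][y]` at `z ∈ F[x]`. [folklore] -/
private theorem eval_optionEquivLeft (H : MvPolynomial (Option β) F) (z : MvPolynomial β F) :
    Polynomial.eval z (optionEquivLeft F β H) = aeval (fun o : Option β => o.elim z X) H := by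
  have key : ((Polynomial.aeval z : Polynomial (MvPolynomial β F) →ₐ[MvPolynomial β F]
      MvPolynomial β F).restrictScalars F).comp
        (optionEquivLeft F β : MvPolynomial (Option β) F →ₐ[F] Polynomial (MvPolynomial β F)) =
      aeval (fun o : Option β => o.elim z X) := by
    refine MvPolynomial.algHom_ext fun o => ?_
    rcases o with _ | b
    · simp
    · simp
  have := AlgHom.congr_fun key H
  simpa [Polynomial.coe_aeval_eq_eval] using this

/-- Translating the `x`-variables, `x_b ↦ x_b + a_b` (and `y ↦ y`), acts on `F[x][y]`
coefficientwise. [folklore] -/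
private theorem optionEquivLeft_aeval_translate (a : β → F) (G : MvPolynomial (Option β) F) :
    optionEquivLeft F β
        (aeval (fun o : Option β => o.elim (X none) fun b => X (some b) + C (a b)) G) =
      Polynomial.mapAlgHom (aeval fun b : β => X b + C (a b)) (optionEquivLeft F β G) := by
  have key : (optionEquivLeft F β : MvPolynomial (Option β) F →ₐ[F]
      Polynomial (MvPolynomial β F)).comp
        (aeval fun o : Option β => o.elim (X none) fun b => X (some b) + C (a b)) =
      (Polynomial.mapAlgHom (aeval fun b : β => X b + C (a b))).comp
        (optionEquivLeft F β : MvPolynomial (Option β) F →ₐ[F] Polynomial (MvPolynomial β F)) := by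
    refine MvPolynomial.algHom_ext fun o => ?_
    rcases o with _ | b
    · simp [Polynomial.coe_mapAlgHom]
    · simp [Polynomial.coe_mapAlgHom]
  exact AlgHom.congr_fun key G

/-- The constant term after the translation `x ↦ x + a` is the value at `a`. [folklore] -/
private theorem constantCoeff_aeval_translate (a : β → F) (u : MvPolynomial β F) :
    constantCoeff (aeval (fun b : β => X b + C (a b)) u) = eval a u := by
  have key : (constantCoeff : MvPolynomial β F →+* F).comp
      (aeval (R := F) fun b : β => X b + C (a b)).toRingHom = eval a := by
    refine MvPolynomial.ringHom_ext (fun c => ?_) (fun b => ?_)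
    · simp
    · simp
  exact RingHom.congr_fun key u

/-- Translating back: `x ↦ x - a` after `x ↦ x + a` is the identity. [folklore] -/
private theorem aeval_translate_neg_translate (a : β → F) (p : MvPolynomial β F) :
    aeval (fun b : β => X b + C (-a b)) (aeval (fun b : β => X b + C (a b)) p) = p := by
  have key : (aeval fun b : β => X b + C (-a b) : MvPolynomial β F →ₐ[F] MvPolynomial β F).comp
      (aeval fun b : β => X b + C (a b)) = AlgHom.id F _ := by
    refine MvPolynomial.algHom_ext fun b => ?_
    simp only [AlgHom.comp_apply, aeval_X, map_add, aeval_C, algebraMap_eq, AlgHom.id_apply,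
      map_neg, add_assoc, neg_add_cancel, add_zero]
  exact AlgHom.congr_fun key p

/-- A substitution by polynomials of degree `≤ 1` does not raise the total degree. [folklore] -/
private theorem totalDegree_aeval_le_linear_aux {γ : Type*} {t : β → MvPolynomial γ F}
    (ht : ∀ b, (t b).totalDegree ≤ 1) (p : MvPolynomial β F) :
    (aeval t p).totalDegree ≤ p.totalDegree := by
  classical
  conv_lhs => rw [p.as_sum]
  rw [map_sum]
  refine totalDegree_finsetSum_le fun m hm => ?_
  rw [aeval_monomial, algebraMap_eq]
  refine (totalDegree_mul _ _).trans ?_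
  rw [totalDegree_C, zero_add]
  simp only [Finsupp.prod]
  refine (totalDegree_finsetProd _ _).trans ?_
  calc ∑ i ∈ m.support, (t i ^ m i).totalDegree ≤ ∑ i ∈ m.support, m i := by
        refine Finset.sum_le_sum fun i _ => (totalDegree_pow _ _).trans ?_
        calc m i * (t i).totalDegree ≤ m i * 1 := Nat.mul_le_mul_left _ (ht i)
          _ = m i := mul_one _
    _ ≤ p.totalDegree := by
        have := le_totalDegree hm
        simpa only [Finsupp.sum] using this

end Subst

/-! ### Vanishing order and the Newton invariant -/

section Newton

variable {F : Type*} [Field F] {β : Type*}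

/-- Vanishing to order `j` (all homogeneous components below degree `j` vanish) in terms of the
support. [folklore] -/
private theorem vanish_iff {j : ℕ} {p : MvPolynomial β F} :
    (∀ i < j, homogeneousComponent i p = 0) ↔ ∀ m ∈ p.support, j ≤ m.degree := by
  constructor
  · intro h m hm
    by_contra hlt
    push Not at hlt
    have hc := congrArg (coeff m) (h _ hlt)
    rw [coeff_homogeneousComponent, if_pos rfl, coeff_zero] at hc
    exact (mem_support_iff.1 hm) hc
  · intro h i hi
    exact homogeneousComponent_eq_zero' _ _ fun m hm => by have := h m hm; omega

/-- Vanishing orders add under multiplication. [folklore] -/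
private theorem vanish_mul {i j : ℕ} {p q : MvPolynomial β F}
    (hp : ∀ k < i, homogeneousComponent k p = 0) (hq : ∀ k < j, homogeneousComponent k q = 0) :
    ∀ k < i + j, homogeneousComponent k (p * q) = 0 := by
  classical
  rw [vanish_iff] at hp hq ⊢
  intro m hm
  open Pointwise in
  obtain ⟨m₁, hm₁, m₂, hm₂, rfl⟩ := Finset.mem_add.1 (support_mul p q hm)
  rw [map_add]
  exact add_le_add (hp _ hm₁) (hq _ hm₂)

/-- A polynomial minus its constant term vanishes to order `1`. [folklore] -/
private theorem vanish_sub_C (p : MvPolynomial β F) :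
    ∀ k < 1, homogeneousComponent k (p - C (coeff 0 p)) = 0 := by
  intro k hk
  obtain rfl : k = 0 := by omega
  rw [map_sub, homogeneousComponent_zero, homogeneousComponent_zero, coeff_zero_C, sub_self]

/-- **The Newton invariant** (Dvir–Shpilka–Yehudayoff 2009, Lemma 3.1; Dutta–Saxena–Sinhababu
2018, §1.3 "slow Newton iteration"): if `φ(g) = 0` and the constant term `ξ` of `φ'(g)` is a
nonzero scalar, the iterates `z_0 = g(0)`, `z_{r+1} = z_r - ξ⁻¹ φ(z_r)` satisfy
`z_r ≡ g (mod ⟨x⟩^{r+1})`. [cite: DuttaSaxenaSinhababu2018, §1.3] -/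
theorem newton_iterate_vanish (φ : Polynomial (MvPolynomial β F)) (g : MvPolynomial β F)
    (hroot : φ.eval g = 0) {ξ : F} (hξ : coeff 0 ((Polynomial.derivative φ).eval g) = ξ)
    (hξ0 : ξ ≠ 0) (r : ℕ) :
    ∀ k < r + 1, homogeneousComponent k
      ((fun z => z - C ξ⁻¹ * φ.eval z)^[r] (C (coeff 0 g)) - g) = 0 := by
  induction r with
  | zero =>
    intro k hk
    rw [Function.iterate_zero_apply, ← neg_sub, map_neg, vanish_sub_C g k hk, neg_zero]
  | succ r ih =>
    rw [Function.iterate_succ_apply']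
    set z := (fun z => z - C ξ⁻¹ * φ.eval z)^[r] (C (coeff 0 g))
    set D := (Polynomial.derivative φ).eval g with hD
    obtain ⟨c, hc⟩ := Polynomial.binomExpansion φ g (z - g)
    have hgz : g + (z - g) = z := by ring
    rw [hgz, hroot, zero_add] at hc
    have hinv : C ξ⁻¹ * C ξ = (1 : MvPolynomial β F) := by
      rw [← C_mul, inv_mul_cancel₀ hξ0, C_1]
    have hid : z - C ξ⁻¹ * φ.eval z - g = (-ξ⁻¹) • ((D - C ξ) * (z - g) + c * (z - g) ^ 2) := by
      rw [hc, smul_eq_C_mul, map_neg]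
      linear_combination (-(z - g)) * hinv
    have h1 : ∀ k < 1, homogeneousComponent k (D - C ξ) = 0 := by
      rw [← hξ]; exact vanish_sub_C D
    have h2 := vanish_mul h1 ih
    have h3 : ∀ k < 0, homogeneousComponent k c = 0 := fun k hk => absurd hk (Nat.not_lt_zero k)
    have h4 := vanish_mul h3 (vanish_mul ih ih)
    intro k hk
    rw [hid, map_smul, map_add, h2 k (by omega), pow_two, h4 k (by omega), add_zero, smul_zero]

/-- If `q ≡ g (mod ⟨x⟩^{D+1})` and `deg g ≤ D` then the truncation of `q` at degree `D` is `g`.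
[folklore] -/
private theorem sum_homogeneousComponent_eq_of_vanish {D : ℕ} {q g : MvPolynomial β F}
    (h : ∀ k < D + 1, homogeneousComponent k (q - g) = 0) (hD : g.totalDegree ≤ D) :
    ∑ i ∈ range (D + 1), homogeneousComponent i q = g := by
  have heq : ∀ i ∈ range (D + 1), homogeneousComponent i q = homogeneousComponent i g :=
    fun i hi => by
      have := h i (mem_range.1 hi)
      rwa [map_sub, sub_eq_zero] at this
  rw [sum_congr rfl heq]
  calc ∑ i ∈ range (D + 1), homogeneousComponent i g
      = ∑ i ∈ range (g.totalDegree + 1), homogeneousComponent i g := by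
        refine (Finset.sum_subset (Finset.range_mono (by omega)) fun i hi hi' => ?_).symm
        refine homogeneousComponent_eq_zero _ _ ?_
        simp only [mem_range, not_lt] at hi hi'
        omega
    _ = g := sum_homogeneousComponent g

variable [Fintype β]

/-- `L(y^j) ≤ j`. [folklore] -/
private theorem complexity_X_pow_le_aux {σ : Type*} (v : σ) (j : ℕ) :
    complexity (X v ^ j : MvPolynomial σ F) ≤ j := by
  induction j with
  | zero => rw [pow_zero, ← C_1, complexity_C_holds]
  | succ j ih =>
    rw [pow_succ]
    calc complexity (X v ^ j * X v) ≤ complexity (X v ^ j : MvPolynomial σ F) +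
          complexity (X v : MvPolynomial σ F) + 1 := complexity_mul_le_holds _ _
      _ ≤ j + 0 + 1 := by gcongr; exact (complexity_X_holds v).le

/-- One Newton step is ONE substitution into the fixed polynomial `y - ξ⁻¹ G(x, y)`; hence the
`r`-th iterate from a constant costs `≤ r (L(G) + 2)`. [cite: DuttaSaxenaSinhababu2018, §1.3] -/
theorem complexity_newton_iterate_le (G : MvPolynomial (Option β) F) (ξ c : F) (r : ℕ) :
    complexity ((fun z => z - C ξ⁻¹ * (optionEquivLeft F β G).eval z)^[r] (C c)) ≤
      r * (complexity G + 2) := by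
  classical
  have hstep : ∀ z : MvPolynomial β F,
      aeval (fun o : Option β => o.elim z X) (X none + C (-ξ⁻¹) * G) =
        z - C ξ⁻¹ * (optionEquivLeft F β G).eval z := by
    intro z
    rw [eval_optionEquivLeft]
    simp only [map_add, map_mul, aeval_X, aeval_C, algebraMap_eq, Option.elim_none, map_neg]
    ring
  have hG'c : complexity (X none + C (-ξ⁻¹) * G) ≤ complexity G + 2 := by
    calc complexity (X none + C (-ξ⁻¹) * G) ≤ complexity (X none : MvPolynomial (Option β) F) +
          complexity (C (-ξ⁻¹) * G) + 1 := complexity_add_le_holds _ _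
      _ ≤ 0 + (complexity (C (-ξ⁻¹) : MvPolynomial (Option β) F) + complexity G + 1) + 1 := by
          gcongr
          · exact (complexity_X_holds _).le
          · exact complexity_mul_le_holds _ _
      _ = complexity G + 2 := by rw [complexity_C_holds]; ring
  induction r with
  | zero => rw [Function.iterate_zero_apply, complexity_C_holds]; exact Nat.zero_le _
  | succ r ih =>
    have hsumX : ∑ b : β, complexity (X b : MvPolynomial β F) = 0 :=
      Finset.sum_eq_zero fun b _ => complexity_X_holds (k := F) b
    rw [Function.iterate_succ_apply', ← hstep]
    calc complexity (aeval (fun o : Option β =>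
            o.elim ((fun z => z - C ξ⁻¹ * (optionEquivLeft F β G).eval z)^[r] (C c)) X)
            (X none + C (-ξ⁻¹) * G))
        ≤ complexity (X none + C (-ξ⁻¹) * G) + ∑ o : Option β, complexity ((fun o : Option β =>
            o.elim ((fun z => z - C ξ⁻¹ * (optionEquivLeft F β G).eval z)^[r] (C c)) X) o) :=
          complexity_aeval_le _ _
      _ = complexity (X none + C (-ξ⁻¹) * G) +
            complexity ((fun z => z - C ξ⁻¹ * (optionEquivLeft F β G).eval z)^[r] (C c)) := by
          rw [Fintype.sum_option]
          simp only [Option.elim_none, Option.elim_some, hsumX, add_zero]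
      _ ≤ (complexity G + 2) + r * (complexity G + 2) := add_le_add hG'c ih
      _ = (r + 1) * (complexity G + 2) := by ring

/-- **Newton iteration with linear convergence** (Dvir–Shpilka–Yehudayoff 2009, Lemma 3.1;
Dutta–Saxena–Sinhababu 2018, §1.3; Bürgisser 2004): if `g ∈ F[x]` is a root of `G(x, y)` and
the constant term of `∂_y G(x, g(x))` is a nonzero scalar, then
`L(g) ≤ (D+2)² · D · (L(G) + 2) + D + 1` for every `D ≥ deg g` — `D` substitutions into the
fixed polynomial `y - ξ⁻¹ G` followed by one truncation at degree `D`.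
[cite: DuttaSaxenaSinhababu2018, §1.3] -/
theorem complexity_le_of_simpleRoot (G : MvPolynomial (Option β) F) (g : MvPolynomial β F)
    (hroot : (optionEquivLeft F β G).eval g = 0)
    (hsimple : coeff 0 ((Polynomial.derivative (optionEquivLeft F β G)).eval g) ≠ 0)
    {D : ℕ} (hD : g.totalDegree ≤ D) :
    complexity g ≤ (D + 2) ^ 2 * (D * (complexity G + 2)) + (D + 1) := by
  set T : MvPolynomial β F := (fun z => z -
      C (coeff 0 ((Polynomial.derivative (optionEquivLeft F β G)).eval g))⁻¹ *
        (optionEquivLeft F β G).eval z)^[D] (C (coeff 0 g)) with hT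
  have hsum : ∑ i ∈ range (D + 1), homogeneousComponent i T = g :=
    sum_homogeneousComponent_eq_of_vanish
      (newton_iterate_vanish (optionEquivLeft F β G) g hroot rfl hsimple D) hD
  have hTc : complexity T ≤ D * (complexity G + 2) := complexity_newton_iterate_le G _ _ D
  calc complexity g = complexity (∑ i ∈ range (D + 1), homogeneousComponent i T) := by rw [hsum]
    _ ≤ (D + 2) ^ 2 * complexity T + (D + 1) := complexity_sum_homogeneousComponent_le T D
    _ ≤ (D + 2) ^ 2 * (D * (complexity G + 2)) + (D + 1) := by gcongr

end Newton

/-! ### The `y`-derivatives of `H` by interpolation -/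

section Derivatives

variable {F : Type*} [Field F] [CharZero F] {β : Type*}

/-- **Interpolation of the `y`-coefficients**: for `d ≥ deg_y H` and `i ≤ d`,
`[y^i] H = Σ_{a=0}^{d} λ_{i,a} · H(x, a)` with the dual Vandermonde coefficients of the nodes
`0, …, d`. [cite: DuttaSaxenaSinhababu2018, proof of Thm. 3] -/
theorem sum_vandermondeDual_smul_aeval_eq_coeff (H : MvPolynomial (Option β) F) {d : ℕ}
    (hd : H.degreeOf none ≤ d) {i : ℕ} (hi : i ≤ d) :
    ∑ a ∈ range (d + 1), vandermondeDual F d i a •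
        aeval (fun o : Option β => o.elim (C (a : F)) X) H = (optionEquivLeft F β H).coeff i := by
  set φ := optionEquivLeft F β H with hφ
  have hdeg : φ.natDegree < d + 1 := by rw [hφ, natDegree_optionEquivLeft]; omega
  have heval : ∀ a : ℕ, aeval (fun o : Option β => o.elim (C (a : F)) X) H =
      ∑ e ∈ range (d + 1), ((a : F) ^ e) • φ.coeff e := by
    intro a
    rw [← eval_optionEquivLeft H (C (a : F)), Polynomial.eval_eq_sum_range' hdeg]
    refine sum_congr rfl fun e _ => ?_
    rw [smul_eq_C_mul, map_pow, mul_comm]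
  calc ∑ a ∈ range (d + 1), vandermondeDual F d i a •
          aeval (fun o : Option β => o.elim (C (a : F)) X) H
      = ∑ a ∈ range (d + 1), ∑ e ∈ range (d + 1),
          (vandermondeDual F d i a * (a : F) ^ e) • φ.coeff e := by
        refine sum_congr rfl fun a _ => ?_
        rw [heval a, smul_sum]
        refine sum_congr rfl fun e _ => ?_
        rw [smul_smul]
    _ = ∑ e ∈ range (d + 1), ∑ a ∈ range (d + 1),
          (vandermondeDual F d i a * (a : F) ^ e) • φ.coeff e := sum_comm
    _ = ∑ e ∈ range (d + 1), (if i = e then (1 : F) else 0) • φ.coeff e := by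
        refine sum_congr rfl fun e he => ?_
        rw [← sum_smul, sum_vandermondeDual_mul_pow F d (Nat.lt_succ_iff.1 (mem_range.1 he)) i]
    _ = φ.coeff i := by
        simp_rw [ite_smul, one_smul, zero_smul]
        rw [Finset.sum_ite_eq, if_pos (mem_range.2 (Nat.lt_succ_of_le hi))]

variable [Fintype β]

/-- The `y`-coefficients of `H` cost `≤ (d+1)(L(H)+2)` each (`d + 1` specialisations, free, and
a linear combination). [cite: DuttaSaxenaSinhababu2018, proof of Thm. 3] -/
theorem complexity_coeff_optionEquivLeft_le (H : MvPolynomial (Option β) F) {d : ℕ}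
    (hd : H.degreeOf none ≤ d) (i : ℕ) :
    complexity ((optionEquivLeft F β H).coeff i) ≤ (d + 1) * (complexity H + 2) := by
  classical
  by_cases hi : i ≤ d
  · rw [← sum_vandermondeDual_smul_aeval_eq_coeff H hd hi]
    calc complexity (∑ a ∈ range (d + 1), vandermondeDual F d i a •
            aeval (fun o : Option β => o.elim (C (a : F)) X) H)
        ≤ ∑ a ∈ range (d + 1), complexity (vandermondeDual F d i a •
            aeval (fun o : Option β => o.elim (C (a : F)) X) H) + (range (d + 1)).card :=
          complexity_finset_sum_le _ _
      _ ≤ ∑ a ∈ range (d + 1), (complexity H + 1) + (range (d + 1)).card := by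
          gcongr with a ha
          calc complexity (vandermondeDual F d i a •
                aeval (fun o : Option β => o.elim (C (a : F)) X) H)
              ≤ complexity (aeval (fun o : Option β => o.elim (C (a : F)) X) H) + 1 :=
                complexity_smul_le_holds _ _
            _ ≤ (complexity H + ∑ o : Option β,
                  complexity ((fun o : Option β => o.elim (C (a : F)) X) o)) + 1 := by
                gcongr; exact complexity_aeval_le _ _
            _ = complexity H + 1 := by
                have hsumX : ∑ b : β, complexity (X b : MvPolynomial β F) = 0 :=
                  Finset.sum_eq_zero fun b _ => complexity_X_holds (k := F) b
                rw [Fintype.sum_option]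
                simp only [Option.elim_none, Option.elim_some, hsumX, add_zero,
                  complexity_C_holds (k := F) (σ := β) (a : F)]
      _ = (d + 1) * (complexity H + 2) := by
          rw [sum_const, card_range, smul_eq_mul]; ring
  · have h0 : (optionEquivLeft F β H).coeff i = 0 :=
      Polynomial.coeff_eq_zero_of_natDegree_lt (by rw [natDegree_optionEquivLeft]; omega)
    rw [h0, ← C_0, complexity_C_holds]
    exact Nat.zero_le _

/-- Arithmetic for the derivative bound. [folklore] -/
private theorem deriv_bound_arith (L d : ℕ) :
    (d + 1) * ((d + 1) * (L + 2) + 1 + d + 1) + (d + 1) ≤ (d + 2) ^ 2 * (L + 4) := by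
  nlinarith [Nat.zero_le (d * L), Nat.zero_le d, Nat.zero_le L, Nat.zero_le (d * d)]

/-- **The `y`-derivatives of `H` have small circuits**: for `d ≥ deg_y H` and every `k`,
`L(∂_y^k H) ≤ (d+2)² (L(H) + 4)` — write `∂_y^k H = Σ_j (j+k)!/j! · [y^{j+k}]H · y^j` and use the
interpolated coefficients. [cite: DuttaSaxenaSinhababu2018, proof of Thm. 3] -/
theorem complexity_optionEquivLeft_symm_iterate_derivative_le (H : MvPolynomial (Option β) F)
    (k : ℕ) {d : ℕ} (hd : H.degreeOf none ≤ d) :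
    complexity ((optionEquivLeft F β).symm
        (Polynomial.derivative^[k] (optionEquivLeft F β H))) ≤ (d + 2) ^ 2 * (complexity H + 4) := by
  classical
  set φ := optionEquivLeft F β H with hφ
  set ψ := Polynomial.derivative^[k] φ with hψ
  have hψdeg : ψ.natDegree < d + 1 :=
    lt_of_le_of_lt ((Polynomial.natDegree_iterate_derivative φ k).trans (Nat.sub_le _ _))
      (by rw [hφ, natDegree_optionEquivLeft]; omega)
  have hexp : (optionEquivLeft F β).symm ψ =
      ∑ j ∈ range (d + 1), rename some (ψ.coeff j) * X none ^ j := by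
    conv_lhs => rw [Polynomial.as_sum_range' ψ (d + 1) hψdeg]
    rw [map_sum]
    refine sum_congr rfl fun j _ => ?_
    rw [← Polynomial.C_mul_X_pow_eq_monomial, map_mul, map_pow]
    simp only [optionEquivLeft_symm_apply, Polynomial.aevalTower_C, Polynomial.aevalTower_X]
  have hcoeff : ∀ j, complexity (ψ.coeff j) ≤ (d + 1) * (complexity H + 2) + 1 := fun j => by
    rw [hψ, Polynomial.coeff_iterate_derivative, ← Nat.cast_smul_eq_nsmul F]
    exact (complexity_smul_le_holds _ _).trans
      (by gcongr; exact complexity_coeff_optionEquivLeft_le H hd _)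
  rw [hexp]
  calc complexity (∑ j ∈ range (d + 1), rename some (ψ.coeff j) * X none ^ j)
      ≤ ∑ j ∈ range (d + 1), complexity (rename some (ψ.coeff j) * X none ^ j :
          MvPolynomial (Option β) F) + (range (d + 1)).card := complexity_finset_sum_le _ _
    _ ≤ ∑ j ∈ range (d + 1), ((d + 1) * (complexity H + 2) + 1 + d + 1) +
          (range (d + 1)).card := by
        gcongr with j hj
        have hj' : j < d + 1 := mem_range.1 hj
        calc complexity (rename some (ψ.coeff j) * X none ^ j : MvPolynomial (Option β) F)
            ≤ complexity (rename some (ψ.coeff j) : MvPolynomial (Option β) F) +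
                complexity (X none ^ j : MvPolynomial (Option β) F) + 1 :=
              complexity_mul_le_holds _ _
          _ ≤ ((d + 1) * (complexity H + 2) + 1) + d + 1 := by
              gcongr
              · exact (complexity_rename_le_holds' _ _).trans (hcoeff j)
              · exact (complexity_X_pow_le_aux _ _).trans (by omega)
    _ = (d + 1) * ((d + 1) * (complexity H + 2) + 1 + d + 1) + (d + 1) := by
        rw [sum_const, card_range, smul_eq_mul]
    _ ≤ (d + 2) ^ 2 * (complexity H + 4) := deriv_bound_arith _ _

end Derivatives

/-! ### The theorem -/

section Main

variable {F : Type*} [Field F] [CharZero F] {β : Type*} [Fintype β]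

/-- **Closure under roots (fine form).** Over a field of characteristic zero: if `H ≠ 0` and
`H(x, f(x)) = 0` then
`L(f) ≤ #β + ((δ+2)² · δ · ((d+2)² (L(H)+4) + #β + 2) + δ + 1)`, `δ = deg f`, `d = deg_y H`
(differentiate to a simple root, translate, Newton-iterate, truncate, translate back).
[cite: DuttaSaxenaSinhababu2018, §1.3 and proof of Thm. 3] -/
theorem complexity_le_of_isRoot (f : MvPolynomial β F) {H : MvPolynomial (Option β) F}
    (hH : H ≠ 0) (hroot : bind₁ (fun o : Option β => o.elim f X) H = 0) :
    complexity f ≤ Fintype.card β +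
      ((f.totalDegree + 2) ^ 2 * (f.totalDegree *
          (((H.degreeOf none + 2) ^ 2 * (complexity H + 4) + Fintype.card β) + 2)) +
        (f.totalDegree + 1)) := by
  classical
  set φ := optionEquivLeft F β H with hφ
  have hφ0 : φ ≠ 0 := (EmbeddingLike.map_ne_zero_iff).2 hH
  have hφroot : φ.IsRoot f := by
    rw [Polynomial.IsRoot, hφ, eval_optionEquivLeft, aeval_eq_bind₁]
    exact hroot
  obtain ⟨m, hm_eq⟩ : ∃ m, φ.rootMultiplicity f = m + 1 :=
    Nat.exists_eq_add_one_of_ne_zero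
      (Nat.pos_iff_ne_zero.1 ((Polynomial.rootMultiplicity_pos hφ0).2 hφroot))
  set ψ := Polynomial.derivative^[m] φ with hψ
  have hψroot : ψ.eval f = 0 :=
    (Polynomial.isRoot_iterate_derivative_of_lt_rootMultiplicity (p := φ) (t := f) (n := m)
      (by omega)).eq_zero
  have hψ' : Polynomial.derivative ψ = Polynomial.derivative^[m + 1] φ := by
    rw [hψ, ← Function.iterate_succ_apply' Polynomial.derivative m φ]
  set u := (Polynomial.derivative ψ).eval f with hu_def
  have hu : u ≠ 0 := by
    have key := Polynomial.eval_iterate_derivative_rootMultiplicity (p := φ) (t := f)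
    rw [hm_eq] at key
    rw [hu_def, hψ', key, nsmul_eq_mul]
    refine mul_ne_zero ?_ ?_
    · exact_mod_cast Nat.factorial_ne_zero (m + 1)
    · have := Polynomial.eval_divByMonic_pow_rootMultiplicity_ne_zero f hφ0
      rwa [hm_eq] at this
  -- a point where `u` does not vanish (`F` is infinite)
  obtain ⟨a, ha⟩ : ∃ a : β → F, eval a u ≠ 0 := by
    by_contra h
    push Not at h
    exact hu (MvPolynomial.funext fun a => by rw [h a, map_zero])
  -- translate by `a`
  set t : β → MvPolynomial β F := fun b => X b + C (a b) with ht
  set θ : Option β → MvPolynomial (Option β) F :=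
    fun o => o.elim (X none) fun b => X (some b) + C (a b) with hθ
  set g : MvPolynomial β F := aeval t f with hg
  set G : MvPolynomial (Option β) F := aeval θ ((optionEquivLeft F β).symm ψ) with hG
  have hGψ : optionEquivLeft F β G = Polynomial.mapAlgHom (aeval t) ψ := by
    rw [hG, hθ, ht, optionEquivLeft_aeval_translate, AlgEquiv.apply_symm_apply]
  have hevmap : ∀ χ : Polynomial (MvPolynomial β F),
      (Polynomial.mapAlgHom (aeval t) χ).eval g = aeval t (χ.eval f) := by
    intro χ
    rw [Polynomial.coe_mapAlgHom, Polynomial.eval_map, hg]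
    have := Polynomial.eval₂_at_apply (p := χ)
      ((aeval t : MvPolynomial β F →ₐ[F] MvPolynomial β F) : MvPolynomial β F →+* MvPolynomial β F) f
    simpa only [RingHom.coe_coe] using this
  have hGroot : (optionEquivLeft F β G).eval g = 0 := by
    rw [hGψ, hevmap, hψroot, map_zero]
  have hGsimple : coeff 0 ((Polynomial.derivative (optionEquivLeft F β G)).eval g) ≠ 0 := by
    have hder : Polynomial.derivative (Polynomial.mapAlgHom (aeval t) ψ) =
        Polynomial.mapAlgHom (aeval t) (Polynomial.derivative ψ) := by
      rw [Polynomial.coe_mapAlgHom, Polynomial.derivative_map]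
    rw [hGψ, hder, hevmap, ← hu_def, ← constantCoeff_eq, ht, constantCoeff_aeval_translate]
    exact ha
  have hgdeg : g.totalDegree ≤ f.totalDegree :=
    totalDegree_aeval_le_linear_aux (fun b => (totalDegree_add _ _).trans
      (max_le (totalDegree_X (R := F) b).le (by rw [totalDegree_C]; exact Nat.zero_le _))) f
  have hNewton := complexity_le_of_simpleRoot G g hGroot hGsimple hgdeg
  -- the cost of `G`
  have hGc : complexity G ≤ (H.degreeOf none + 2) ^ 2 * (complexity H + 4) + Fintype.card β := by
    calc complexity G ≤ complexity ((optionEquivLeft F β).symm ψ) +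
          ∑ o : Option β, complexity (θ o) := complexity_aeval_le _ _
      _ ≤ (H.degreeOf none + 2) ^ 2 * (complexity H + 4) + ∑ _b : β, 1 := by
          refine add_le_add (complexity_optionEquivLeft_symm_iterate_derivative_le H m le_rfl) ?_
          rw [Fintype.sum_option, hθ]
          simp only [Option.elim_none, Option.elim_some]
          rw [complexity_X_holds, zero_add]
          refine Finset.sum_le_sum fun b _ => ?_
          calc complexity (X (some b) + C (a b) : MvPolynomial (Option β) F)
              ≤ complexity (X (some b) : MvPolynomial (Option β) F) +
                  complexity (C (a b) : MvPolynomial (Option β) F) + 1 := complexity_add_le_holds _ _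
            _ = 1 := by rw [complexity_X_holds, complexity_C_holds]
      _ = (H.degreeOf none + 2) ^ 2 * (complexity H + 4) + Fintype.card β := by
          rw [sum_const, card_univ, smul_eq_mul, mul_one]
  -- translate back
  have hf : aeval (fun b : β => X b + C (-a b)) g = f := by
    rw [hg, ht]; exact aeval_translate_neg_translate a f
  calc complexity f = complexity (aeval (fun b : β => X b + C (-a b)) g) := by rw [hf]
    _ ≤ complexity g + ∑ b : β, complexity (X b + C (-a b) : MvPolynomial β F) :=
        complexity_aeval_le _ _
    _ ≤ complexity g + ∑ _b : β, 1 := by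
        gcongr with b _
        calc complexity (X b + C (-a b) : MvPolynomial β F)
            ≤ complexity (X b : MvPolynomial β F) + complexity (C (-a b) : MvPolynomial β F) + 1 :=
              complexity_add_le_holds _ _
          _ = 1 := by rw [complexity_X_holds, complexity_C_holds]
    _ = Fintype.card β + complexity g := by
        rw [sum_const, card_univ, smul_eq_mul, mul_one, add_comm]
    _ ≤ _ := by
        gcongr
        exact hNewton.trans (by gcongr)

/-- Arithmetic for the coarse form. [folklore] -/
private theorem root_bound_arith (L T δ n d : ℕ) (hd : d ≤ T) :
    n + ((δ + 2) ^ 2 * (δ * (((d + 2) ^ 2 * (L + 4) + n) + 2)) + (δ + 1)) ≤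
      (L + T + δ + n + 4) ^ 7 := by
  set B := L + T + δ + n + 4 with hB
  have hB4 : 4 ≤ B := by omega
  have h1 : (d + 2) ^ 2 * (L + 4) + n + 2 ≤ B ^ 3 + B := by
    have : (d + 2) ^ 2 * (L + 4) ≤ B ^ 2 * B :=
      Nat.mul_le_mul (Nat.pow_le_pow_left (by omega) 2) (by omega)
    calc (d + 2) ^ 2 * (L + 4) + n + 2 ≤ B ^ 2 * B + B := by omega
      _ = B ^ 3 + B := by ring
  have h2 : δ * (((d + 2) ^ 2 * (L + 4) + n) + 2) ≤ B * (B ^ 3 + B) :=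
    Nat.mul_le_mul (by omega) (by simpa [add_assoc] using h1)
  have h3 : (δ + 2) ^ 2 * (δ * (((d + 2) ^ 2 * (L + 4) + n) + 2)) ≤ B ^ 2 * (B * (B ^ 3 + B)) :=
    Nat.mul_le_mul (Nat.pow_le_pow_left (by omega) 2) h2
  have h4 : B ^ 4 ≤ B ^ 6 := Nat.pow_le_pow_right (by omega) (by omega)
  have h5 : B ≤ B ^ 6 := by
    calc B = B ^ 1 := (pow_one B).symm
      _ ≤ B ^ 6 := Nat.pow_le_pow_right (by omega) (by omega)
  have h6 : 4 * B ^ 6 ≤ B ^ 7 := by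
    calc 4 * B ^ 6 ≤ B * B ^ 6 := Nat.mul_le_mul_right _ hB4
      _ = B ^ 7 := by ring
  have h7 : B ^ 2 * (B * (B ^ 3 + B)) = B ^ 6 + B ^ 4 := by ring
  omega

/-- **Closure under roots (coarse form): if `H ≠ 0` and `H(x, f(x)) = 0` then
`L(f) ≤ (L(H) + deg H + deg f + #β + 4)^7`** over any field of characteristic zero — the root
case of Kaltofen's factor theorem (Bürgisser 2024 Thm. 3.2 / the tree's named fact
`KaltofenFactorBoundWith`, there for arbitrary factors), which is the case used by
Kabanets–Impagliazzo 2003 Lemma 30 and Kumar–Ramya–Saptharishi–Tengse 2022 Lemma 8; PROVED.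
[cite: DuttaSaxenaSinhababu2018, §1.3 and proof of Thm. 3] -/
theorem complexity_le_pow_of_isRoot (f : MvPolynomial β F) {H : MvPolynomial (Option β) F}
    (hH : H ≠ 0) (hroot : bind₁ (fun o : Option β => o.elim f X) H = 0) :
    complexity f ≤
      (complexity H + H.totalDegree + f.totalDegree + Fintype.card β + 4) ^ 7 :=
  (complexity_le_of_isRoot f hH hroot).trans
    (root_bound_arith _ _ _ _ _ (degreeOf_le_totalDegree H none))

end Main

end Literature.Computability.AlgebraicComplexity

end
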